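import Mathlib
import HarnessLib

/-!
# Integral modular forms with an indicator constant term (Edixhoven 1997, Lemma 1.9) — the named fact

Topic `Literature/NumberTheory/ModularForms`. ONE named fact (D-0014), no proofs, Mathlib-only
imports: `Edixhoven1997_exists_integralForm_cuspIndicator`, VERBATIM the hypothesis binder `hX` of
the accepted reductions
`Literature.NumberTheory.EllipticCurves.BillereyMenares2016_thm22_exists_newform_odd_of_integralCuspIndicator`
and `…_exists_newform_of_integralCuspIndicator`
(`EllipticCurves/EisensteinNewformLevelRaisingCuspFormLiftProofs.lean` ll. 768–790, p117167) —
librarian sweep g24, vend-from-binder, promote events 3355226 / 3344733 (the provefact seat may not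
mint it, `lint.fact-fanout`). First consumers: those reductions, so that
`BillereyMenares2016_thm22_exists_newform_odd_holds := …_of_integralCuspIndicator
  Edixhoven1997_exists_integralForm_cuspIndicator_holds` (and likewise `…_exists_newform`) the day
this fact is a theorem; it is the ONLY unproved input of `BillereyMenares2016_thm22_exists_newform_odd`.

## Source and reading

B. Edixhoven, *Serre's conjecture*, in Cornell–Silverman–Stevens (eds.), *Modular Forms and
Fermat's Last Theorem* (Springer 1997), Lemma 1.9 and its proof, (1.9.1): for `p ∤ L`, `k ≥ 3`
(and `L ≥ 5` or the usual smallness caveat at `p ≤ 3`), `H¹(X₁(L)_{ℤ_p}, ω^{⊗k}(−cusps)) = 0`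
(Kodaira–Spencer `ω² ≅ Ω¹(cusps)` and Serre duality / ampleness), so the constant-term map
`M_k(Γ₁(L); ℤ_p) → ⊕_{cusps} ℤ_p` is SURJECTIVE: any prescribed cuspidal constant-term vector is the
constant term of a `p`-INTEGRAL modular form. Equivalent classical sources: Katz, *p-adic properties
of modular schemes and modular forms* (Antwerp III, LNM 350, 1973), §1.2, Cor. 1.6.2, Thm. 1.7.1;
Diamond–Im, *Modular forms and modular curves* (1995), §12.3 (Thm. 12.3.4, Rem. 12.3.5, Thm. 12.3.7).
The CLASSICAL SHADOW recorded here (no modular curves over `ℤ[1/L]` in the tree): for every prime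
`p ∤ L` (with `L ≠ 1 ∨ 3 < p`), every weight `k ≥ 3`, every field identification
`ι : ℚ̄_p ≃+* ℂ` (fixing what "`p`-integral" means for complex `q`-expansions) and every cusp
representative `γ₀ ∈ SL(2, ℤ)`, there is `H ∈ M_k(Γ₁(L))` whose `q`-expansions at all `Γ₀(L)`-translates
are `p`-integral (`Valued.v (ι.symm aₙ) ≤ 1`) and whose constant term at the cusp `γ` is the
INDICATOR of the `Γ₁(L)`-orbit of `γ₀` (with the sign `(−1)^k` on the orbit of `−γ₀`):
the value of `H ∣[k] γ` at `i∞`.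

What is deliberately NOT here: the vanishing of `H¹` itself, integral structures on `M_k`, the cusps
of `X₁(L)` as a scheme — discharging the fact is theory-sized (modular curves over `ℤ[1/N]`).
-/

noncomputable section

open scoped MatrixGroups ModularForm Topology
open CongruenceSubgroup UpperHalfPlane Filter

namespace Literature.NumberTheory.ModularForms

open Classical in
/-- **Edixhoven 1997, Lemma 1.9 (classical shadow): integral modular forms on `Γ₁(L)` of weight
`k ≥ 3` with an indicator constant term at a prescribed cusp.** For every prime `p`, every level
`L` with `p ∤ L` and (`L ≠ 1` or `3 < p`), every weight `k ≥ 3`, every ring isomorphism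
`ι : PadicAlgCl p ≃+* ℂ` and every `γ₀ ∈ SL(2, ℤ)`, there is a modular form `H ∈ M_k(Γ₁(L))` such
that (i) for every `σ ∈ Γ₀(L)` all `q`-expansion coefficients of `H ∣[k] σ` are `p`-integral
through `ι` (`Valued.v (ι.symm ((qExpansion 1 (H ∣[k] σ)).coeff n)) ≤ 1`), and (ii) for every
`γ ∈ SL(2, ℤ)` the value of `H ∣[k] γ` at `i∞` (the limit along `atImInfty`) is
`[γ ∈ Γ₁(L) Tℤ γ₀] + (−1)^k [−γ ∈ Γ₁(L) Tℤ γ₀]` — the indicator of the cusp of `γ₀` (surjectivity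
of the constant-term map `M_k(Γ₁(L); ℤ_p) → ⊕_{cusps} ℤ_p`, from
`H¹(X₁(L)_{ℤ_p}, ω^{⊗k}(−cusps)) = 0`, Lemma 1.9 and (1.9.1); Katz 1973 Cor. 1.6.2, Thm. 1.7.1;
Diamond–Im 1995 §12.3). VERBATIM the binder `hX` of
`BillereyMenares2016_thm22_exists_newform_odd_of_integralCuspIndicator`; users take
`(hX : Edixhoven1997_exists_integralForm_cuspIndicator)`. Named fact (D-0014), not proved in the tree.
[cite: Edixhoven1997, Lemma 1.9 and its proof, (1.9.1)]
[cite: Katz1973, §1.2, Cor. 1.6.2 and Thm. 1.7.1] [cite: DiamondIm1995, §12.3 (Thm. 12.3.4, Rem. 12.3.5, Thm. 12.3.7)] -/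
def Edixhoven1997_exists_integralForm_cuspIndicator : Prop :=
  ∀ (p : ℕ) [Fact p.Prime] (L : ℕ) [NeZero L], ¬ p ∣ L → (L ≠ 1 ∨ 3 < p) →
    ∀ (k : ℤ), 3 ≤ k → ∀ (ι : PadicAlgCl p ≃+* ℂ) (γ₀ : SL(2, ℤ)),
    ∃ H : ModularForm (Gamma1 L) k,
      (∀ σ : SL(2, ℤ), σ ∈ Gamma0 L → ∀ n : ℕ,
        Valued.v (ι.symm ((qExpansion 1 ((⇑H : ℍ → ℂ) ∣[k] σ)).coeff n)) ≤ 1) ∧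
      ∀ γ : SL(2, ℤ), Tendsto ((⇑H : ℍ → ℂ) ∣[k] γ) atImInfty
        (𝓝 ((if ∃ j : ℤ, γ * ModularGroup.T ^ j * γ₀⁻¹ ∈ Gamma1 L then (1 : ℂ) else 0) +
          (if ∃ j : ℤ, -(γ * ModularGroup.T ^ j * γ₀⁻¹) ∈ Gamma1 L then (-1 : ℂ) ^ k else 0)))

end Literature.NumberTheory.ModularForms

end
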